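/-
Copyright (c) 2026 the pub-hodgecm-mathlib formalisation cell (harness21).  R90-TF SLAB, section S10 (Rogawski 1990, Ch. 13.8), prover R90-C138-p01 (g0):
DEAL #20-a = RULING J-M3-5 (i)(ii)(iii) «SPLIT ROAD OF RECORD = ABSTRACT-`I`» (dealer R90-C138-plan (g3) 2026-09-05T01:24:01Z);
h413 = `stmt-HodgeConjecture-24833`, route `HCCMUnconditional`.
-/
import Summits.HodgeConjecture.HodgeConjecture.Theorems.R90S10UnramCharIdentityOfInputLetters   -- ★ p08 (B) bridge: `UnramCharIdentityLetter`, ★ p863649 letters (1)–(3), ★ (M5), ★ C2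
import Summits.HodgeConjecture.HodgeConjecture.Theorems.R90S10SphericalConstituentTrace        -- ★ p863695: `smoothTrace_eq_of_isSpherical_isConstituentOf` (the (α) engine)
import Literature.NumberTheory.Automorphic.UnitaryGroupConstantTermSplit                       -- ★ `UnitaryGroup.cmSplitTransfer` (the NAMED split transfer `φ ↦ τ_w · φ̄^P`)
import Summits.HodgeConjecture.HodgeConjecture.Theorems.R90S10PSSplitInputLettersDefs          -- ★ p06 FILE 1: (M-a) `SplitHVanDijkLetter`, (M-b) `SplitInductionInStagesLetter` (for the reduction (M-b) ⇒ (M-b′) only)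
import HarnessLib

/-!
# R90-TF ∕ S10 — THE ABSTRACT-`I` LETTERS OF THE SPLIT ROAD (RULING J-M3-5): (3′) `PSLocalCharTransferAbstractLetter`, (M-b′) `SplitAbstractTransferLetter`,
# and the bridge′ `exists_unramCharIdentityLetter_of_abstractLetter` (DEAL #20-a)

Cell hodgecm-mathlib, slab R90-TF, section S10 = [Rogawski1990] §13.8 (p. 219 L3 «`π_v = ξ_H(ρ_v)` for all `v ≠ w`»), crux item h413 = `stmt-HodgeConjecture-24833`;
DEFINITIONS (`def … : Prop`, `Iff.rfl` read-backs) + three proved bridges; lane `--kind definition --supports stmt-HodgeConjecture-24833 --as helper`; no instance, no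
notation, no named fact, no `sorry`; LAW L9 (★ `Theorems` ∕ `Literature` imports only).

RULING J-M3-5 (dealer (g3), additions only; ★ letter (3) `PSLocalCharTransferLetter` and p06's ★ (M-a)(M-b) letters UNCHANGED).  The consumer ★ C2 `LiesOver` reads level pairs
and p08's ★ (M3) `UnramCharIdentityLetter` is `∃ W I, (α) ∧ (β″)` with `I` ABSTRACT; the clause `Nonempty (I.Equiv (cmPrincipalSeries L 3 w χt))` of letter (3) served only to
feed (2) `PSLineTraceLetter`, and the (α) engine ★ `smoothTrace_eq_of_isSpherical_isConstituentOf` needs neither a model nor finite length.  Hence at a SPLIT `w` the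
letters drop the identification with `cmPrincipalSeries`:
* §1 **(3′) `PSLocalCharTransferAbstractLetter L μ w KG KHw νQw νHw mHw mQw`** := ★ p863649 letter (3)'s binders ∕ guards VERBATIM, conclusion
  `∃ W I, I.IsAdmissible ∧ finrank I^{KG} = 1 ∧ (β″)-body` (= (3)'s conclusion minus `χt` and `Nonempty (I.Equiv …) ∧`); `psLocalCharTransferAbstractLetter_iff` (`Iff.rfl`);
  `psLocalCharTransferAbstractLetter_of_letter : (3) → (3′)` (drop `χt`, `hI`).
* §2 **(M-b′) `SplitAbstractTransferLetter L μ w νQw νHw`** := p06's ★ (M-b) `SplitInductionInStagesLetter` binders VERBATIM, conclusion `∃ Wsp I, I.IsAdmissible ∧ ∀ φ, IsLocSmooth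
  φ → Tr I(φ) = Tr ρ_w(τ_w · φ̄^P)` with ★ `UnitaryGroup.cmSplitTransfer` (no `χt`, no `Equiv`); `splitAbstractTransferLetter_iff`; `splitAbstractTransferLetter_of_letter :
  (M-b) → (M-b′)`.
* §3 **bridge′ `exists_unramCharIdentityLetter_of_abstractLetter`** = ★ `exists_unramCharIdentityLetter_of_inputLetters` (p08) with `hα` DROPPED and
  `(hβ : PSLocalCharTransferAbstractLetter …)`: the spherical constituent `π_w` of the abstract partner `I` through its `K_w`-line (★
  `IrrClass.exists_isConstituentOf_smoothTrace_doubleCoset_of_heckeEigenvector`, ★ `IsSpherical.exists_isHeckeEigenAt`), (α) by ★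
  `smoothTrace_eq_of_isSpherical_isConstituentOf`; and the given-class twin **`unramCharIdentityLetter_of_abstractLetter`** (e.v.p. pin `hevp`, ★ (M5-c)
  `unramCharIdentityLetter_of_isSphericalWith`).
CONSUMERS (J-M3-5 (iv)): the payer of (3′) at an unramified `w ≠ v` case-splits — split `w`: p06 FILE 2′ from (M-a) ★ (p03) + (M-b′) (p08 `splitAbstractTransferLetter_holds`);
non-split `w`: `psLocalCharTransferAbstractLetter_of_letter (localCharTransfer_cmPrincipalSeries_of_canonical … hns)` (p05).

HONEST LABEL: letters and bridges pay nothing by themselves; HC_CM is proved only modulo the 7 printed citations (2 remaining named inputs: hLiu418 = `stmt-HodgeConjecture-24832`,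
h413 = `stmt-HodgeConjecture-24833`) until rung 0 closes; REL ≠ ★ ≠ BUILT.

## References
* [Rogawski1990] J. Rogawski, *Automorphic Representations of Unitary Groups in Three Variables*, Ann. of Math. Stud. 123 (1990), §4.9 Lemma 4.9.2 pp. 55–56; §4.13
  Lemma 4.13.1 (b) pp. 64–66; §12.1 p. 171; §13.1 p. 199 ¶3; §13.6 p. 209; §13.8 p. 218 L9 (ii), p. 219 L3.
* [vanDijk1972] G. van Dijk, *Computation of certain induced characters of 𝔭-adic groups*, Math. Ann. 199 (1972), Thm. p. 237.
* [CartierCorvallis1979] P. Cartier, *Representations of 𝔭-adic groups: a survey*, Proc. Sympos. Pure Math. 33.1 (1979), §IV.1.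
* [BorelJacquet1979] A. Borel, H. Jacquet, *Automorphic forms and automorphic representations*, Proc. Sympos. Pure Math. 33.1 (1979), §4.4.
-/

set_option autoImplicit false
set_option linter.dupNamespace false

noncomputable section

open scoped RestrictedProduct Matrix MatrixGroups
open Filter MeasureTheory NumberField IsDedekindDomain CompactlySupported MulAction
open Literature.NumberTheory.Rogawski1990 Literature.NumberTheory.Automorphic Literature.NumberTheory.Automorphic.UnitaryGroup
open Literature.NumberTheory.Automorphic.UnitaryGroup.CotangentForms Literature.NumberTheory.GaloisRepresentations
open Summit.HodgeConjecture.HodgeConjecture.Cruxes.H413.K2E1TraceFormulaBeta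

namespace Summit.HodgeConjecture.HodgeConjecture.R90.S10

/-! ## §1 (3′) Lemma 4.9.2 at an unramified place with an ABSTRACT transfer partner `I` -/

/-- **(3′) `PSLocalCharTransferAbstractLetter L μ w KG KHw νQw νHw mHw mQw`** — ★ letter (3) `PSLocalCharTransferLetter` (⟪U⟫ guard at `w`, hyperspecial level pins
`KG = U(Φ₃)(𝒪_w)`, `KHw = U(Φ₂)(𝒪_w) × U(Φ₁)(𝒪_w)`, unit volumes; for every irreducible-type datum `ρ_w ≅ i_H(χ₂ ⊠ χ₁)`, `χ₁` smooth, with a `K_H`-line) with the SAME binders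
and guards and the ABSTRACT conclusion: there is an ADMISSIBLE `I` on `G_w = U(Φ₃)(L⁺_w)` with `I^{K}` a LINE carrying p08's (β″)-body `∀ (f^H, φ)` C2-matched,
`Tr I(φ) = Tr ρ_w(f^H)` — (3)'s conclusion minus the model clause `χt`, `Nonempty (I.Equiv (cmPrincipalSeries L 3 w χt))` (RULING J-M3-5: the consumer ★ `UnramCharIdentityLetter`
is abstract in `I`).  Print: Lemma 4.9.2 (4.9.2) `Tr i_H(χ)(f^H) = Tr i_G(χ̃)(f)`, `ε_w = κ_w = 1` at unramified data [p. 56, p. 199 ¶3].  Why it might fail: only through the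
`Δ‴` of record differing from print's `Δ` by a sign at an unramified `w` (as for (3)); the split case is J-M3-5 (iv)'s (M-a)+(M-b′), the non-split case p05's (β″)′.
[cite: Rogawski1990, §4.9 Lemma 4.9.2, (4.9.2), (4.9.4) pp. 55–56; §13.1 p. 199 ¶3; §13.8 p. 218 L9 (ii), p. 219 L3] [cite: vanDijk1972, Thm. p. 237] -/
def PSLocalCharTransferAbstractLetter (L : Type) [Field L] [NumberField L] [IsCMField L] (μ : HeckeCharacter L) (w : Pl L)
    {_msH : MeasurableSpace (HLoc L w)} {_msG : MeasurableSpace (Gqs L w)} [BorelSpace (HLoc L w)] [BorelSpace (Gqs L w)]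
    {_qH : ∀ a : HLoc L w, MeasurableSpace (HLoc L w ⧸ Subgroup.centralizer ({a} : Set (HLoc L w)))}
    {_qQ : ∀ γ : Gqs L w, MeasurableSpace (Gqs L w ⧸ Subgroup.centralizer ({γ} : Set (Gqs L w)))}
    (KG : Subgroup (Gqs L w)) (KHw : Subgroup (HLoc L w)) (νQw : Measure (Gqs L w)) (νHw : Measure (HLoc L w))
    [νQw.IsHaarMeasure] [νHw.IsHaarMeasure] (mHw : OrbitalMeasureFamily (HLoc L w)) (mQw : OrbitalMeasureFamily (Gqs L w)) : Prop :=
  (∀ W : PlacesOver L w, Algebra.IsUnramifiedAt (𝓞 ↥(maximalRealSubfield L)) W.1.asIdeal ∧ μ.IsUnramifiedAt W.1) →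
    KG = cmLocalIntegralLevel L 3 (qsForm L) w →
    KHw = (cmLocalIntegralLevel L 2 (Matrix.of fun i j : Fin 2 => if i.val + j.val + 1 = 2 then (1 : L) else 0) w).prod
      (cmLocalIntegralLevel L 1 (Matrix.of fun i j : Fin 1 => if i.val + j.val + 1 = 1 then (1 : L) else 0) w) →
    νHw (KHw : Set (HLoc L w)) = 1 → νQw (KG : Set (Gqs L w)) = 1 →
      ∀ (χ₂ : ↥(torusU (conjLocal L (IsCMField.complexConj L) w) (cmLocalForm L 2 w)) →* ℂˣ) (χ₁ : H1Loc L w →* ℂˣ),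
        IsOpen ((χ₁.ker : Subgroup (H1Loc L w)) : Set (H1Loc L w)) →
          ∀ ⦃Vw : Type⦄ [AddCommGroup Vw] [Module ℂ Vw] (ρw : Representation ℂ (HLoc L w) Vw),
            Nonempty (ρw.Equiv (cmPrincipalSeriesH L w χ₂ χ₁)) → Module.finrank ℂ ↥(ρw.fixedPoints KHw) = 1 →
              ∃ (W : Type) (_ : AddCommGroup W) (_ : Module ℂ W) (I : Representation ℂ (Gqs L w) W),
                I.IsAdmissible ∧ Module.finrank ℂ ↥(I.fixedPoints KG) = 1 ∧
                  ∀ (fH : HLoc L w → ℂ) (φ : Gqs L w → ℂ), MatchE1 L μ w mHw mQw fH φ → I.smoothTrace νQw φ = ρw.smoothTrace νHw fH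

/-- Read-back, `Iff.rfl`. [cite: Rogawski1990, §4.9 Lemma 4.9.2 pp. 55–56] -/
theorem psLocalCharTransferAbstractLetter_iff (L : Type) [Field L] [NumberField L] [IsCMField L] (μ : HeckeCharacter L) (w : Pl L)
    {_msH : MeasurableSpace (HLoc L w)} {_msG : MeasurableSpace (Gqs L w)} [BorelSpace (HLoc L w)] [BorelSpace (Gqs L w)]
    {_qH : ∀ a : HLoc L w, MeasurableSpace (HLoc L w ⧸ Subgroup.centralizer ({a} : Set (HLoc L w)))}
    {_qQ : ∀ γ : Gqs L w, MeasurableSpace (Gqs L w ⧸ Subgroup.centralizer ({γ} : Set (Gqs L w)))}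
    (KG : Subgroup (Gqs L w)) (KHw : Subgroup (HLoc L w)) (νQw : Measure (Gqs L w)) (νHw : Measure (HLoc L w))
    [νQw.IsHaarMeasure] [νHw.IsHaarMeasure] (mHw : OrbitalMeasureFamily (HLoc L w)) (mQw : OrbitalMeasureFamily (Gqs L w)) :
    PSLocalCharTransferAbstractLetter L μ w KG KHw νQw νHw mHw mQw ↔
      ((∀ W : PlacesOver L w, Algebra.IsUnramifiedAt (𝓞 ↥(maximalRealSubfield L)) W.1.asIdeal ∧ μ.IsUnramifiedAt W.1) →
        KG = cmLocalIntegralLevel L 3 (qsForm L) w →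
        KHw = (cmLocalIntegralLevel L 2 (Matrix.of fun i j : Fin 2 => if i.val + j.val + 1 = 2 then (1 : L) else 0) w).prod
          (cmLocalIntegralLevel L 1 (Matrix.of fun i j : Fin 1 => if i.val + j.val + 1 = 1 then (1 : L) else 0) w) →
        νHw (KHw : Set (HLoc L w)) = 1 → νQw (KG : Set (Gqs L w)) = 1 →
          ∀ (χ₂ : ↥(torusU (conjLocal L (IsCMField.complexConj L) w) (cmLocalForm L 2 w)) →* ℂˣ) (χ₁ : H1Loc L w →* ℂˣ),
            IsOpen ((χ₁.ker : Subgroup (H1Loc L w)) : Set (H1Loc L w)) →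
              ∀ ⦃Vw : Type⦄ [AddCommGroup Vw] [Module ℂ Vw] (ρw : Representation ℂ (HLoc L w) Vw),
                Nonempty (ρw.Equiv (cmPrincipalSeriesH L w χ₂ χ₁)) → Module.finrank ℂ ↥(ρw.fixedPoints KHw) = 1 →
                  ∃ (W : Type) (_ : AddCommGroup W) (_ : Module ℂ W) (I : Representation ℂ (Gqs L w) W),
                    I.IsAdmissible ∧ Module.finrank ℂ ↥(I.fixedPoints KG) = 1 ∧
                      ∀ (fH : HLoc L w → ℂ) (φ : Gqs L w → ℂ), MatchE1 L μ w mHw mQw fH φ → I.smoothTrace νQw φ = ρw.smoothTrace νHw fH) :=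
  Iff.rfl

/-- **(3) ⇒ (3′)**: forget the model clause (`χt` and `Nonempty (I.Equiv (cmPrincipalSeries L 3 w χt))`). [cite: Rogawski1990, §4.9 Lemma 4.9.2 pp. 55–56] -/
theorem psLocalCharTransferAbstractLetter_of_letter (L : Type) [Field L] [NumberField L] [IsCMField L] (μ : HeckeCharacter L) (w : Pl L)
    {_msH : MeasurableSpace (HLoc L w)} {_msG : MeasurableSpace (Gqs L w)} [BorelSpace (HLoc L w)] [BorelSpace (Gqs L w)]
    {_qH : ∀ a : HLoc L w, MeasurableSpace (HLoc L w ⧸ Subgroup.centralizer ({a} : Set (HLoc L w)))}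
    {_qQ : ∀ γ : Gqs L w, MeasurableSpace (Gqs L w ⧸ Subgroup.centralizer ({γ} : Set (Gqs L w)))}
    (KG : Subgroup (Gqs L w)) (KHw : Subgroup (HLoc L w)) (νQw : Measure (Gqs L w)) (νHw : Measure (HLoc L w))
    [νQw.IsHaarMeasure] [νHw.IsHaarMeasure] (mHw : OrbitalMeasureFamily (HLoc L w)) (mQw : OrbitalMeasureFamily (Gqs L w))
    (h : PSLocalCharTransferLetter L μ w KG KHw νQw νHw mHw mQw) : PSLocalCharTransferAbstractLetter L μ w KG KHw νQw νHw mHw mQw :=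
  fun hU hKG hKH hvolH hvolG χ₂ χ₁ hχ₁ _Vw _ _ ρw hρ hline => by
    obtain ⟨_χt, W, _, _, I, -, hadmI, hlineI, hβI⟩ := h hU hKG hKH hvolH hvolG χ₂ χ₁ hχ₁ ρw hρ hline
    exact ⟨W, inferInstance, inferInstance, I, hadmI, hlineI, hβI⟩

/-! ## §2 (M-b′) the NAMED split transfer with an ABSTRACT partner `I` -/

/-- **(M-b′) `SplitAbstractTransferLetter L μ w νQw νHw`** — p06's ★ (M-b) `SplitInductionInStagesLetter` with the SAME binders (every place `W ∣ w` with `c • W ≠ W`, every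
inducing pair `(χ₂, χ₁)` with `χ₁` smooth, every realisation `ρ_w ≅ i_H(χ₂ ⊠ χ₁)`) and the ABSTRACT conclusion: there is an ADMISSIBLE `I` on `G_w` with, for every locally smooth
`φ`, `Tr I(φ) = Tr ρ_w(τ_w · φ̄^P)` at the NAMED split transfer ★ `UnitaryGroup.cmSplitTransfer L Φ₃ _ _ w W hW μ νHw νQw φ` — no `χt`, no `Equiv` (RULING J-M3-5 (ii)).  Print:
parabolic descent `Tr Ind_{P_(2,1)}^{GL₃}(σ̃)(φ) = Tr σ̃(φ̄^P)` [Lemma 4.13.1 (b), van Dijk] for the block-Levi datum of `ρ_w ⊗ (μ_W ∘ det ∘ e₂)` (payer p08: ★ J1 `splitSigmaDictionary_GL3`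
+ ★ `GLn.vanDijkTraceParabolicIndGL_admissible` + ★ J2 `splitTransport_parabolicIndGL3` + (M-d) for the constant `1` at unit volumes).  Why it might fail: the normalisation
constant `νQw(K′)∕νHw(K_M)` inside ★ `cmSplitTransfer` for non-matching Haar measures (the letter binds arbitrary ones) — carried identically on both sides of the payer's chain.
[cite: Rogawski1990, §4.13 Lemma 4.13.1 (b) pp. 64–66; §4.9 Lemma 4.9.2 pp. 55–56; §12.1 p. 171] [cite: vanDijk1972, Thm. p. 237] -/
def SplitAbstractTransferLetter (L : Type) [Field L] [NumberField L] [IsCMField L] (μ : HeckeCharacter L) (w : Pl L)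
    {_msH : MeasurableSpace (HLoc L w)} {_msG : MeasurableSpace (Gqs L w)} [BorelSpace (HLoc L w)] [BorelSpace (Gqs L w)]
    (νQw : Measure (Gqs L w)) (νHw : Measure (HLoc L w)) [νQw.IsHaarMeasure] [νHw.IsHaarMeasure] : Prop :=
  ∀ (W : PlacesOver L w) (hW : IsCMField.complexConj L • W.1 ≠ W.1)
    (χ₂ : ↥(torusU (conjLocal L (IsCMField.complexConj L) w) (cmLocalForm L 2 w)) →* ℂˣ) (χ₁ : H1Loc L w →* ℂˣ),
    IsOpen ((χ₁.ker : Subgroup (H1Loc L w)) : Set (H1Loc L w)) →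
    ∀ ⦃Vw : Type⦄ [AddCommGroup Vw] [Module ℂ Vw] (ρw : Representation ℂ (HLoc L w) Vw),
      Nonempty (ρw.Equiv (cmPrincipalSeriesH L w χ₂ χ₁)) →
      ∃ (Wsp : Type) (_ : AddCommGroup Wsp) (_ : Module ℂ Wsp) (I : Representation ℂ (Gqs L w) Wsp),
        I.IsAdmissible ∧
          ∀ φ : Gqs L w → ℂ, IsLocSmooth φ →
            I.smoothTrace νQw φ =
              ρw.smoothTrace νHw (UnitaryGroup.cmSplitTransfer L (qsForm L) (antidiagOne_isHermitian L 3) (isUnit_antidiagOne_det L 3) w W hW μ νHw νQw φ)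

/-- Read-back, `Iff.rfl`. [cite: Rogawski1990, §4.13 Lemma 4.13.1 (b) p. 64] -/
theorem splitAbstractTransferLetter_iff (L : Type) [Field L] [NumberField L] [IsCMField L] (μ : HeckeCharacter L) (w : Pl L)
    {_msH : MeasurableSpace (HLoc L w)} {_msG : MeasurableSpace (Gqs L w)} [BorelSpace (HLoc L w)] [BorelSpace (Gqs L w)]
    (νQw : Measure (Gqs L w)) (νHw : Measure (HLoc L w)) [νQw.IsHaarMeasure] [νHw.IsHaarMeasure] :
    SplitAbstractTransferLetter L μ w νQw νHw ↔
      ∀ (W : PlacesOver L w) (hW : IsCMField.complexConj L • W.1 ≠ W.1)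
        (χ₂ : ↥(torusU (conjLocal L (IsCMField.complexConj L) w) (cmLocalForm L 2 w)) →* ℂˣ) (χ₁ : H1Loc L w →* ℂˣ),
        IsOpen ((χ₁.ker : Subgroup (H1Loc L w)) : Set (H1Loc L w)) →
        ∀ ⦃Vw : Type⦄ [AddCommGroup Vw] [Module ℂ Vw] (ρw : Representation ℂ (HLoc L w) Vw),
          Nonempty (ρw.Equiv (cmPrincipalSeriesH L w χ₂ χ₁)) →
          ∃ (Wsp : Type) (_ : AddCommGroup Wsp) (_ : Module ℂ Wsp) (I : Representation ℂ (Gqs L w) Wsp),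
            I.IsAdmissible ∧
              ∀ φ : Gqs L w → ℂ, IsLocSmooth φ →
                I.smoothTrace νQw φ =
                  ρw.smoothTrace νHw (UnitaryGroup.cmSplitTransfer L (qsForm L) (antidiagOne_isHermitian L 3) (isUnit_antidiagOne_det L 3) w W hW μ νHw νQw φ) :=
  Iff.rfl

/-- **(M-b) ⇒ (M-b′)**: forget the model clause of p06's `SplitInductionInStagesLetter`. [cite: Rogawski1990, §4.13 Lemma 4.13.1 (b) p. 64] -/
theorem splitAbstractTransferLetter_of_letter (L : Type) [Field L] [NumberField L] [IsCMField L] (μ : HeckeCharacter L) (w : Pl L)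
    {_msH : MeasurableSpace (HLoc L w)} {_msG : MeasurableSpace (Gqs L w)} [BorelSpace (HLoc L w)] [BorelSpace (Gqs L w)]
    (νQw : Measure (Gqs L w)) (νHw : Measure (HLoc L w)) [νQw.IsHaarMeasure] [νHw.IsHaarMeasure]
    (h : SplitInductionInStagesLetter L μ w νQw νHw) : SplitAbstractTransferLetter L μ w νQw νHw :=
  fun W hW χ₂ χ₁ hχ₁ _Vw _ _ ρw hρ => by
    obtain ⟨_χt, Wsp, _, _, I, -, hadmI, hI⟩ := h W hW χ₂ χ₁ hχ₁ ρw hρ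
    exact ⟨Wsp, inferInstance, inferInstance, I, hadmI, hI⟩

/-! ## §3 bridge′: the abstract letter (3′) ⇒ p08's (M3) `UnramCharIdentityLetter` -/

section Bridge

variable (L : Type) [Field L] [NumberField L] [IsCMField L] (μ : HeckeCharacter L) (w : Pl L)
  [MeasurableSpace (HLoc L w)] [BorelSpace (HLoc L w)] [MeasurableSpace (Gqs L w)] [BorelSpace (Gqs L w)]
  [∀ a : HLoc L w, MeasurableSpace (HLoc L w ⧸ Subgroup.centralizer ({a} : Set (HLoc L w)))]
  [∀ γ : Gqs L w, MeasurableSpace (Gqs L w ⧸ Subgroup.centralizer ({γ} : Set (Gqs L w)))]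
  (KG : Subgroup (Gqs L w)) (KHw : Subgroup (HLoc L w)) (νQw : Measure (Gqs L w)) (νHw : Measure (HLoc L w))
  [νQw.IsHaarMeasure] [νHw.IsHaarMeasure] (mHw : OrbitalMeasureFamily (HLoc L w)) (mQw : OrbitalMeasureFamily (Gqs L w))

/-- **THE BRIDGE′, ∃-FORM — «ξ_H(ρ_w) EXISTS AS A CLASS SATISFYING (M3)» from the ABSTRACT letter (3′) ALONE** (★ `exists_unramCharIdentityLetter_of_inputLetters` with `hα`
DROPPED): at an unramified place (⟪U⟫ guard, level pins, unit volumes), for `ρ_w ≅ i_H(χ₂ ⊠ χ₁)` with a `K_H`-line, there is an ADMISSIBLE `K_w`-spherical class `π_w` with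
`UnramCharIdentityLetter … π_w ρ_w` — the spherical constituent of the abstract partner `I` through its `K_w`-line (★ `IsSpherical.exists_isHeckeEigenAt`, ★
`IrrClass.exists_isConstituentOf_smoothTrace_doubleCoset_of_heckeEigenvector`), whose (α)-clause is ★ `smoothTrace_eq_of_isSpherical_isConstituentOf` (no model, no finite
length). [cite: Rogawski1990, §13.8 p. 219 L3; §4.9 Lemma 4.9.2 pp. 55–56; §13.1 p. 199 ¶3] [cite: CartierCorvallis1979, §IV.1] [cite: BorelJacquet1979, §4.4] -/
theorem exists_unramCharIdentityLetter_of_abstractLetter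
    (hβ : PSLocalCharTransferAbstractLetter L μ w KG KHw νQw νHw mHw mQw)
    (hKo : IsOpen (KG : Set (Gqs L w))) (hKc : IsCompact (KG : Set (Gqs L w)))
    (hU : ∀ W : PlacesOver L w, Algebra.IsUnramifiedAt (𝓞 ↥(maximalRealSubfield L)) W.1.asIdeal ∧ μ.IsUnramifiedAt W.1)
    (hKG : KG = cmLocalIntegralLevel L 3 (qsForm L) w)
    (hKH : KHw = (cmLocalIntegralLevel L 2 (Matrix.of fun i j : Fin 2 => if i.val + j.val + 1 = 2 then (1 : L) else 0) w).prod
      (cmLocalIntegralLevel L 1 (Matrix.of fun i j : Fin 1 => if i.val + j.val + 1 = 1 then (1 : L) else 0) w))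
    (hvolH : νHw (KHw : Set (HLoc L w)) = 1) (hvolG : νQw (KG : Set (Gqs L w)) = 1)
    (χ₂ : ↥(torusU (conjLocal L (IsCMField.complexConj L) w) (cmLocalForm L 2 w)) →* ℂˣ) (χ₁ : H1Loc L w →* ℂˣ)
    (hχ₁ : IsOpen ((χ₁.ker : Subgroup (H1Loc L w)) : Set (H1Loc L w)))
    {Vw : Type} [AddCommGroup Vw] [Module ℂ Vw] (ρw : Representation ℂ (HLoc L w) Vw)
    (hρ : Nonempty (ρw.Equiv (cmPrincipalSeriesH L w χ₂ χ₁))) (hline : Module.finrank ℂ ↥(ρw.fixedPoints KHw) = 1) :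
    ∃ πw : IrrClass (Gqs L w), πw.IsAdmissible ∧ UnramCharIdentityLetter L μ w KG KHw νQw νHw mHw mQw πw ρw := by
  obtain ⟨W, _, _, I, hadmI, hlineI, hβI⟩ := hβ hU hKG hKH hvolH hvolG χ₂ χ₁ hχ₁ ρw hρ hline
  -- the `K_w`-line of `I` carries Hecke eigen-scalars `t`
  haveI := isHeckeTriple_top_of_isCompact_isOpen KG hKc hKo
  have hfin : ∀ g : Gqs L w, (orbit KG (g : Gqs L w ⧸ KG)).Finite := finite_orbit_quotient KG
  have hsphI : I.IsSpherical KG := hlineI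
  obtain ⟨t, ht⟩ := hsphI.exists_isHeckeEigenAt I KG hfin
  obtain ⟨v₀, hv₀, hv₀0⟩ := (Submodule.ne_bot_iff _).1 hsphI.isUnramified
  -- the spherical constituent through `v₀`
  obtain ⟨c, hc, hadmc, hsphc, -⟩ :=
    IrrClass.exists_isConstituentOf_smoothTrace_doubleCoset_of_heckeEigenvector νQw hKo hKc I hadmI hv₀ hv₀0 (fun g => ht g v₀ hv₀)
  exact ⟨c, hadmc, W, inferInstance, inferInstance, I,
    ⟨hsphc, fun φ hφ hK => smoothTrace_eq_of_isSpherical_isConstituentOf νQw hadmI hlineI hsphc hc hφ.2 hK⟩, hβI⟩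

/-- **THE BRIDGE′ FOR A GIVEN CLASS** — if moreover the GIVEN admissible class `π_w` has the SAME Hecke eigencharacter as every admissible (M3)-partner of `ρ_w` (the e.v.p. pin
(M4) at `w`, hypothesis `hevp`), then `UnramCharIdentityLetter … π_w ρ_w` (★ (M5-c) `unramCharIdentityLetter_of_isSphericalWith`), hence ★ `LiesOver … π_w ρ_w` by ★
`liesOver_of_unramCharIdentityLetter`. [cite: Rogawski1990, §13.8 p. 219 L3; §13.6 p. 209] [cite: CartierCorvallis1979, §IV.1 Cor. 4.1–4.2] -/
theorem unramCharIdentityLetter_of_abstractLetter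
    (hβ : PSLocalCharTransferAbstractLetter L μ w KG KHw νQw νHw mHw mQw)
    (hKo : IsOpen (KG : Set (Gqs L w))) (hKc : IsCompact (KG : Set (Gqs L w))) (hμK : νQw.real (KG : Set (Gqs L w)) ≠ 0)
    (hU : ∀ W : PlacesOver L w, Algebra.IsUnramifiedAt (𝓞 ↥(maximalRealSubfield L)) W.1.asIdeal ∧ μ.IsUnramifiedAt W.1)
    (hKG : KG = cmLocalIntegralLevel L 3 (qsForm L) w)
    (hKH : KHw = (cmLocalIntegralLevel L 2 (Matrix.of fun i j : Fin 2 => if i.val + j.val + 1 = 2 then (1 : L) else 0) w).prod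
      (cmLocalIntegralLevel L 1 (Matrix.of fun i j : Fin 1 => if i.val + j.val + 1 = 1 then (1 : L) else 0) w))
    (hvolH : νHw (KHw : Set (HLoc L w)) = 1) (hvolG : νQw (KG : Set (Gqs L w)) = 1)
    (χ₂ : ↥(torusU (conjLocal L (IsCMField.complexConj L) w) (cmLocalForm L 2 w)) →* ℂˣ) (χ₁ : H1Loc L w →* ℂˣ)
    (hχ₁ : IsOpen ((χ₁.ker : Subgroup (H1Loc L w)) : Set (H1Loc L w)))
    {Vw : Type} [AddCommGroup Vw] [Module ℂ Vw] (ρw : Representation ℂ (HLoc L w) Vw)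
    (hρ : Nonempty (ρw.Equiv (cmPrincipalSeriesH L w χ₂ χ₁))) (hline : Module.finrank ℂ ↥(ρw.fixedPoints KHw) = 1)
    (πw : IrrClass (Gqs L w)) (hadm : πw.IsAdmissible)
    (hevp : ∀ π' : IrrClass (Gqs L w), π'.IsAdmissible → UnramCharIdentityLetter L μ w KG KHw νQw νHw mHw mQw π' ρw →
      ∃ t : (Gqs L w → ℂ) → ℂ, πw.IsSphericalWith KG νQw t ∧ π'.IsSphericalWith KG νQw t) :
    UnramCharIdentityLetter L μ w KG KHw νQw νHw mHw mQw πw ρw := by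
  obtain ⟨π', hadm', hM3'⟩ :=
    exists_unramCharIdentityLetter_of_abstractLetter L μ w KG KHw νQw νHw mHw mQw hβ hKo hKc hU hKG hKH hvolH hvolG χ₂ χ₁ hχ₁ ρw hρ hline
  obtain ⟨t, ht, ht'⟩ := hevp π' hadm' hM3'
  exact unramCharIdentityLetter_of_isSphericalWith L w KG νQw μ KHw νHw mHw mQw ρw hKo hKc hμK hadm hadm' ht ht' hM3'

end Bridge

end Summit.HodgeConjecture.HodgeConjecture.R90.S10

end
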